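import Literature.NumberTheory.Automorphic.CaraianiNewtonModularity
import Literature.NumberTheory.EllipticCurves.GaloisAction
import HarnessLib

/-!
# Modularity of elliptic curves over imaginary quadratic fields with irreducible `E[5]`
# (Caraiani–Newton 2023, Theorem 7.1 (1))

Topic `Literature/NumberTheory/Automorphic`; companion of `CaraianiNewtonModularity.lean`, whose
dictionary `IsModularEllipticCurve F E` ("`E/F` is modular" in the sense of Caraiani–Newton, p. 2)
is reused verbatim. Vendored by a grounder for route `Langlands/FifteenLocusEisenstein`: it
grounds the input crux `Summit.Langlands.Langlands.Theses.FifteenLocusEisenstein.IrreducibleFiveModular`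
(stmt-Langlands-15863), which is this theorem for non-CM curves with the conclusion transported to
the summit's Satake–Frobenius clause for every `ℓ, ι` (that transport uses Lemma 6.1.3 (2) below
and is the route's business, not part of the fact).

A. Caraiani, J. Newton, *On the modularity of elliptic curves over imaginary quadratic fields*,
arXiv:2301.10509 [CaraianiNewton2023], verbatim:

* p. 2: "We say that an elliptic curve `E/F` is modular if either `E` has complex multiplication
  or if there exists a cuspidal automorphic representation `π` of `GL₂(𝔸_F)` of parallel weight
  `2` whose associated `L`-function is the same as the `L`-function of `E`."  (p. 87, after
  Thm. 6.1: "By '`E` is modular', we mean that either `E` has CM, or there is a cuspidal, regular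
  algebraic automorphic representation `π` of `GL₂(𝔸_F)` which is regular algebraic of weight `0`,
  with `r_{π,ι} ≅ r_{E,p}^∨` for a prime `p` and an isomorphism `ι : ℚ̄_p → ℂ`.")
* p. 87: "**Theorem 6.1.** Let `F` be an imaginary CM number field with `ζ₅ ∉ F`. Let `E/F` be an
  elliptic curve satisfying one of the following two conditions: (1) `r̄_{E,3}` is decomposed
  generic and `r̄_{E,3}|_{G_{F(ζ₃)}}` is absolutely irreducible. (2) `r̄_{E,5}` is decomposed
  generic and `r̄_{E,5}|_{G_{F(ζ₅)}}` is absolutely irreducible. Then `E` is modular."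
  "**Corollary 6.1.1.** Let `F` be an imaginary quadratic field. Let `E/F` be an elliptic curve
  satisfying one of the following two conditions: (1) `r̄_{E,3}|_{G_{F(ζ₃)}}` is absolutely
  irreducible. (2) `r̄_{E,5}|_{G_{F(ζ₅)}}` is absolutely irreducible. Then `E` is modular."
* p. 88: "**Lemma 6.1.3.** Let `F` be a CM field and let `E/F` be a modular elliptic curve without
  CM, with `r_{π,ι} ≅ r_{E,p}^∨` for some choice of prime `p` and isomorphism `ι : ℚ̄_p → ℂ`. Then:
  (1) `π` has trivial central character and weight `0`, and is uniquely determined by `E`.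
  (2) For every prime `p` and isomorphism `ι : ℚ̄_p → ℂ`, there is an isomorphism
  `r_{π,ι} ≅ r_{E,p}^∨`. (3) For every isomorphism `ι` and finite place `v ∤ p` of `F`, there is an
  isomorphism `WD(r_{E,p}^∨|_{G_{F_v}})^{F-ss} ≅ rec^T_{F_v}(π_v)`. (4) […]"
* p. 91: "**Theorem 7.1.** Let `F` be an imaginary quadratic field, and let `E/F` be an elliptic
  curve such that one of the following conditions holds: (1) The action of `G_F` on `E[5]` is
  irreducible (not necessarily absolutely irreducible). (2) The action of `G_F` on `E[3]` is
  irreducible and the image of `G_F` in `Aut(E[3])` is not the normalizer of a split Cartan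
  subgroup. Then `E` is modular."  (Proof, §§7.1–7.4: Theorem 6.1 with Lemma 7.1.1 reduces (1) to
  quadratic points on the modular curves `X(ns3°, b5)`, `X(b3, ns5)`, `X(s3, ns5)`, `X(ns3°, ns5)`.)

## Rendering and faithfulness

* `F` imaginary quadratic, "every elliptic curve `E/F`" and "modular" exactly as in
  `CaraianiNewtonModularity.lean`: `NumberField F`, `IsTotallyComplex F`, `Module.finrank ℚ F = 2`;
  an integral Weierstrass model `E` over `𝓞 F` with `Δ(E) ≠ 0`; `IsModularEllipticCurve F E`
  (geometric CM, or a weight-zero cuspidal `π` on `GL₂(𝔸_F)` whose `T_w`-eigenvalue is `a_w(E)`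
  at cofinitely many `w` — the cofinite shadow of `L(π, s) = L(E, s)`, so the rendered conclusion
  is implied by the printed one).
* "The action of `G_F` on `E[5]` is irreducible": the tree's
  `WeierstrassCurve.HasIrreducibleModPGaloisRep 5` for the curve `E.baseChange F` over `F`
  (`GaloisAction.lean`: the only `Γ_F`-stable subgroups of the geometric `5`-torsion `E(F̄)[5]`
  are `⊥` and `⊤` — irreducibility over `𝔽₅`, NOT absolute irreducibility, as printed).
* ONLY clause (1) of Theorem 7.1 is vendored (`CaraianiNewton2023_thm7_1_1`): clause (2) needs
  "the image of `G_F` in `Aut(E[3]) ≅ GL₂(𝔽₃)` is not the normalizer of a split Cartan subgroup",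
  and Theorem 6.1 / Corollary 6.1.1 need absolute irreducibility over `F(ζ_p)` and "decomposed
  generic"; none of these has a rendering in the tree's mod-`p` vocabulary yet, and the requesting
  route consumes clause (1) only. Lemma 6.1.3 is quoted for the route's `ℓ ↔ p` transport and is
  not restated (its objects `r_{π,ι}`, `rec^T` live in `ReciprocityGLn.lean`'s dictionary, where
  the cofinite trace matching of `IsModularEllipticCurve` is already `p`-independent).
* **Euler-factor form (second rendering, same printed theorem).** `IsModularEllipticCurve`
  keeps only the TRACE coefficient of the printed "whose associated `L`-function is the same as
  the `L`-function of `E`" (p. 2) — `q_w^{1/2}(α_w + β_w) = a_w(E)` — and forgets the constant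
  coefficient (`q_w α_w β_w = q_w`, i.e. trivial central character at `ϖ_w`, Lemma 6.1.3 (1)).
  A consumer that needs the full unramified Euler factor (e.g. the point-count clause
  `Σ α⁻¹ = a_w(E) ∧ ∏ α⁻¹ = N w` of
  `Summit.Langlands.Langlands.Theses.FifteenLocusEisenstein.IrreducibleFiveModular`, rev. 3)
  cannot recover it from the trace alone, so the same sentence of the source is ALSO rendered
  with both coefficients: `IsModularEllipticCurveHecke F E` — geometric CM, or a weight-zero
  cuspidal `π` whose Hecke polynomial at cofinitely many `w` is `X² - a_w(E) X + q_w`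
  (`AutomorphicRepData.HasHeckePolynomialAt`, the convention of the accepted
  `IsAutomorphicOfWeightZero` of `ReciprocityGLnPotentialModularity.lean`, there imposed at EVERY
  `w ∤ Δ(E)`; here only cofinitely often — the cofinite shadow of the identity of Euler products
  `L(π, s - 1/2) = L(E, s)`, resp. of `r_{π,ι} ≅ r_{E,p}^∨` (p. 87) read at the unramified places,
  where both sides have characteristic polynomial `X² - a_w X + q_w`, a polynomial invariant
  under `x ↦ q_w/x` so that the arithmetic/geometric Frobenius conventions agree). The fact
  `CaraianiNewton2023_thm7_1_1_hecke` is Theorem 7.1 (1) with this conclusion; it implies the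
  trace-only `CaraianiNewton2023_thm7_1_1` (`CaraianiNewton2023_thm7_1_1_hecke.thm7_1_1`) and is
  implied pointwise by `IsAutomorphicOfWeightZero` (`IsModularEllipticCurveHecke.of_isAutomorphicOfWeightZero`).

## References

* A. Caraiani, J. Newton, arXiv:2301.10509 (2023): p. 2, Thm. 6.1, Cor. 6.1.1, Lemma 6.1.3
  (pp. 87–88), Thm. 7.1 (p. 91). [CaraianiNewton2023]
-/

open scoped NumberField
open NumberField

noncomputable section

namespace Literature.NumberTheory.Automorphic

/-- **Caraiani–Newton (2023), Theorem 7.1 (1): modularity from irreducibility of `E[5]` over an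
imaginary quadratic field.** "Let `F` be an imaginary quadratic field, and let `E/F` be an
elliptic curve such that […] (1) the action of `G_F` on `E[5]` is irreducible (not necessarily
absolutely irreducible) […]. Then `E` is modular." Rendered: for `F` a totally complex number
field of degree `2`, every Weierstrass model `E` over `𝓞 F` with `Δ(E) ≠ 0` whose base change to
`F` has an irreducible mod-`5` Galois representation (`HasIrreducibleModPGaloisRep 5`: no
`Γ_F`-stable subgroup of `E(F̄)[5]` other than `⊥`, `⊤`) is modular in the sense of
`IsModularEllipticCurve` (geometric CM, or a weight-zero cuspidal `π` on `GL₂(𝔸_F)` with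
`T_w`-eigenvalue `a_w(E)` at cofinitely many places). A named fact (D-0014): users take
`(h : CaraianiNewton2023_thm7_1_1)`. Grounds
`Summit.Langlands.Langlands.Theses.FifteenLocusEisenstein.IrreducibleFiveModular`.
[cite: CaraianiNewton2023, Thm. 7.1 (1)] -/
def CaraianiNewton2023_thm7_1_1 : Prop :=
  ∀ (F : Type) [Field F] [NumberField F], IsTotallyComplex F → Module.finrank ℚ F = 2 →
    ∀ E : WeierstrassCurve (𝓞 F), E.Δ ≠ 0 →
      (E.baseChange F).HasIrreducibleModPGaloisRep 5 → IsModularEllipticCurve F E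

/-- Theorem 7.1 (1) contains Theorem 1.1 restricted to curves with irreducible `E[5]`, with no
hypothesis on `X₀(15)(F)`: a curve over ANY imaginary quadratic field whose mod-`5` representation
is irreducible is modular. (Sanity restatement: the fact specialises to each field.) [folklore] -/
theorem CaraianiNewton2023_thm7_1_1.apply (h : CaraianiNewton2023_thm7_1_1)
    {F : Type} [Field F] [NumberField F] (hF : IsTotallyComplex F) (hdeg : Module.finrank ℚ F = 2)
    {E : WeierstrassCurve (𝓞 F)} (hΔ : E.Δ ≠ 0)
    (hirr : (E.baseChange F).HasIrreducibleModPGaloisRep 5) : IsModularEllipticCurve F E :=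
  h F hF hdeg E hΔ hirr

/-! ### "`E` is modular", Euler-factor form (both coefficients of `X² - a_w X + q_w`) -/

/-- **`E/F` is modular, Euler-factor form** (Caraiani–Newton, p. 2: "We say that an elliptic
curve `E/F` is modular if either `E` has complex multiplication or if there exists a cuspidal
automorphic representation `π` of `GL₂(𝔸_F)` of parallel weight `2` whose associated
`L`-function is the same as the `L`-function of `E`"; p. 87: "either `E` has CM, or there is a
cuspidal, regular algebraic automorphic representation `π` of `GL₂(𝔸_F)` which is regular
algebraic of weight `0`, with `r_{π,ι} ≅ r_{E,p}^∨`"). Rendered for an integral Weierstrass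
model `E` over `𝓞 F`: either the base change to `F` has geometric CM, or there is a cuspidal
automorphic representation datum `π` of `GL₂(𝔸_F)` of weight zero (`HasWeightZero`) which at
all but finitely many finite places `w` has Hecke polynomial `X² - a_w(E) X + q_w`
(`AutomorphicRepData.HasHeckePolynomialAt`: `π_w` unramified with Satake parameter `{α₁, α₂}`
and `(X - q_w^{1/2} α₁)(X - q_w^{1/2} α₂) = X² - a_w X + q_w`, `a_w = frobTraceAt E w`,
`frobPoly a q = X² - a X + q`) — the cofinite shadow of `L(π, s - 1/2) = L(E, s)`. Sharper than
`IsModularEllipticCurve` (trace coefficient only, `isModularEllipticCurve`), weaker than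
`IsAutomorphicOfWeightZero` (every `w ∤ Δ(E)`, `of_isAutomorphicOfWeightZero`).
[cite: CaraianiNewton2023, p. 2 (definition of modular) and §6 p. 87 (after Thm. 6.1)] -/
def IsModularEllipticCurveHecke (F : Type) [Field F] [NumberField F]
    (E : WeierstrassCurve (𝓞 F)) : Prop :=
  (E.baseChange F).HasCM ∨
    ∃ (hF : isCompact_glFiniteIntegralLevel 2 F) (π : CuspidalAutomorphicRepData 2 F hF),
      π.1.HasWeightZero ∧
        ∀ᶠ w : IsDedekindDomain.HeightOneSpectrum (𝓞 F) in Filter.cofinite,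
          π.1.HasHeckePolynomialAt w
            ((frobPoly (frobTraceAt E w) w.residueCard).map (Int.castRingHom ℂ))

/-- A curve with geometric CM is modular in the Euler-factor sense by definition (first
alternative). [folklore] -/
theorem IsModularEllipticCurveHecke.of_hasCM {F : Type} [Field F] [NumberField F]
    {E : WeierstrassCurve (𝓞 F)} (h : (E.baseChange F).HasCM) : IsModularEllipticCurveHecke F E :=
  Or.inl h

/-- `IsAutomorphicOfWeightZero E` (Hecke polynomial `X² - a_w X + q_w` at EVERY `w ∤ Δ(E)`)
implies the Euler-factor modularity of a model with `Δ(E) ≠ 0` (only finitely many `w` divide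
`Δ(E)`, `eventually_not_mem_asIdeal`). [folklore] -/
theorem IsModularEllipticCurveHecke.of_isAutomorphicOfWeightZero {F : Type} [Field F]
    [NumberField F] {E : WeierstrassCurve (𝓞 F)} (hΔ : E.Δ ≠ 0)
    (h : IsAutomorphicOfWeightZero E) : IsModularEllipticCurveHecke F E := by
  obtain ⟨hL, π, h0, hH⟩ := h
  exact Or.inr ⟨hL, π, h0, (eventually_not_mem_asIdeal hΔ).mono fun w hw => hH w hw⟩

/-- The Euler-factor form implies the trace form `IsModularEllipticCurve` (read the `X`
coefficient, `exists_hasSatakeParamAt_of_hasHeckePolynomialAt_frobPoly`). [folklore] -/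
theorem IsModularEllipticCurveHecke.isModularEllipticCurve {F : Type} [Field F] [NumberField F]
    {E : WeierstrassCurve (𝓞 F)} (h : IsModularEllipticCurveHecke F E) :
    IsModularEllipticCurve F E := by
  rcases h with h | ⟨hL, π, h0, hH⟩
  · exact Or.inl h
  · refine Or.inr ⟨hL, π, h0, hH.mono fun w hw => ?_⟩
    obtain ⟨α, hα, hsum, -⟩ := exists_hasSatakeParamAt_of_hasHeckePolynomialAt_frobPoly hw
    exact ⟨α, hα, hsum⟩

/-- **Reading the Euler-factor form as the two coefficient identities.** For a curve without
geometric CM that is modular in the Euler-factor sense there is a weight-zero cuspidal `π` of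
`GL₂(𝔸_F)` which at cofinitely many `w` is unramified with a Satake parameter `α = {α₁, α₂}`
satisfying `q_w^{1/2}(α₁ + α₂) = a_w(E)` and `(q_w^{1/2})² α₁ α₂ = q_w` (compare coefficients of
`X² - a_w X + q_w`); the `L`-algebraic twist `π ⊗ |det|^{1/2}` then has parameters
`q_w^{-1/2} α` with `Σ (q_w^{-1/2}α_j)⁻¹ = a_w(E)` and `∏ (q_w^{-1/2}α_j)⁻¹ = q_w` (tree:
`CuspidalAutomorphicRepData.exists_twist_isRegular_isLAlgebraic`,
`AutomorphicRepData.HasSatakeParamAt.of_map_mulChar_detTwist_of_cpow`; not performed here).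
[folklore] -/
theorem IsModularEllipticCurveHecke.exists_hasSatakeParamAt {F : Type} [Field F] [NumberField F]
    {E : WeierstrassCurve (𝓞 F)} (h : IsModularEllipticCurveHecke F E)
    (hCM : ¬ (E.baseChange F).HasCM) :
    ∃ (hL : isCompact_glFiniteIntegralLevel 2 F) (π : CuspidalAutomorphicRepData 2 F hL),
      π.1.HasWeightZero ∧
        ∀ᶠ w : IsDedekindDomain.HeightOneSpectrum (𝓞 F) in Filter.cofinite, ∃ α : Multiset ℂ,
          π.1.HasSatakeParamAt w α ∧
            ((Real.sqrt w.residueCard : ℝ) : ℂ) * α.sum = (frobTraceAt E w : ℂ) ∧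
            ((Real.sqrt w.residueCard : ℝ) : ℂ) ^ 2 * α.prod = (w.residueCard : ℂ) := by
  rcases h with h | ⟨hL, π, h0, hH⟩
  · exact absurd h hCM
  · exact ⟨hL, π, h0,
      hH.mono fun w hw => exists_hasSatakeParamAt_of_hasHeckePolynomialAt_frobPoly hw⟩

/-- **Caraiani–Newton (2023), Theorem 7.1 (1), Euler-factor rendering.** "Let `F` be an
imaginary quadratic field, and let `E/F` be an elliptic curve such that […] (1) The action of
`G_F` on `E[5]` is irreducible (not necessarily absolutely irreducible) […]. Then `E` is
modular" — with "modular" rendered by `IsModularEllipticCurveHecke` (p. 2: parallel weight `2`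
and "whose associated `L`-function is the same as the `L`-function of `E`", read as the Hecke
polynomial `X² - a_w(E) X + q_w` at cofinitely many places; equivalently p. 87,
`r_{π,ι} ≅ r_{E,p}^∨` at the unramified places, with Lemma 6.1.3 (1): trivial central
character). Same hypotheses and same printed theorem as `CaraianiNewton2023_thm7_1_1`, which it
implies (`CaraianiNewton2023_thm7_1_1_hecke.thm7_1_1`). A named fact (D-0014): users take
`(h : CaraianiNewton2023_thm7_1_1_hecke)`. Grounds
`Summit.Langlands.Langlands.Theses.FifteenLocusEisenstein.IrreducibleFiveModular` (rev. 3,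
stmt-Langlands-16057: its point-count clause `Σ α⁻¹ = a_w(E) ∧ ∏ α⁻¹ = N w` for an `L`-algebraic
`π` is this fact for non-CM curves followed by the half-twist `π ⊗ |det|^{1/2}`).
[cite: CaraianiNewton2023, Thm. 7.1 (1) p. 91, with p. 2 and Lemma 6.1.3 (1) p. 88] -/
def CaraianiNewton2023_thm7_1_1_hecke : Prop :=
  ∀ (F : Type) [Field F] [NumberField F], IsTotallyComplex F → Module.finrank ℚ F = 2 →
    ∀ E : WeierstrassCurve (𝓞 F), E.Δ ≠ 0 →
      (E.baseChange F).HasIrreducibleModPGaloisRep 5 → IsModularEllipticCurveHecke F E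

/-- The Euler-factor rendering implies the trace rendering of Theorem 7.1 (1). [folklore] -/
theorem CaraianiNewton2023_thm7_1_1_hecke.thm7_1_1 (h : CaraianiNewton2023_thm7_1_1_hecke) :
    CaraianiNewton2023_thm7_1_1 :=
  fun F _ _ hF hdeg E hΔ hirr => (h F hF hdeg E hΔ hirr).isModularEllipticCurve

/-- **Theorem 7.1 (1) for a non-CM curve, read as coefficient identities**: `F` imaginary
quadratic, `E / 𝓞 F` with `Δ ≠ 0`, no geometric CM and irreducible `E[5]` ⟹ a weight-zero
cuspidal `π` on `GL₂(𝔸_F)` with `q_w^{1/2} Σ α = a_w(E)` and `q_w ∏ α = q_w` at cofinitely many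
`w`. [cite: CaraianiNewton2023, Thm. 7.1 (1)] -/
theorem CaraianiNewton2023_thm7_1_1_hecke.exists_hasSatakeParamAt
    (h : CaraianiNewton2023_thm7_1_1_hecke) {F : Type} [Field F] [NumberField F]
    (hF : IsTotallyComplex F) (hdeg : Module.finrank ℚ F = 2) {E : WeierstrassCurve (𝓞 F)}
    (hΔ : E.Δ ≠ 0) (hCM : ¬ (E.baseChange F).HasCM)
    (hirr : (E.baseChange F).HasIrreducibleModPGaloisRep 5) :
    ∃ (hL : isCompact_glFiniteIntegralLevel 2 F) (π : CuspidalAutomorphicRepData 2 F hL),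
      π.1.HasWeightZero ∧
        ∀ᶠ w : IsDedekindDomain.HeightOneSpectrum (𝓞 F) in Filter.cofinite, ∃ α : Multiset ℂ,
          π.1.HasSatakeParamAt w α ∧
            ((Real.sqrt w.residueCard : ℝ) : ℂ) * α.sum = (frobTraceAt E w : ℂ) ∧
            ((Real.sqrt w.residueCard : ℝ) : ℂ) ^ 2 * α.prod = (w.residueCard : ℂ) :=
  (h F hF hdeg E hΔ hirr).exists_hasSatakeParamAt hCM

end Literature.NumberTheory.Automorphic

end
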